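import Literature.Computability.QuantumComplexity.AaronsonAmbainis

/-!
# Crux `VarianceAmplification` (stmt-QuantumAdvantage-17874, route RandomOracleGauge), line `average-and-clip` — stub `stub_average`, part 1/2 (blocks and moments)

The AVERAGING step of the elementary variance amplifier (line card `Cruxes/AAConj/Lines/average-and-clip.md`):
for a `[0,1]`-bounded `p ∈ ℝ[Fin N]` of total degree `≤ d` and `m ≥ 1`, the centred average of `m` independent
copies

  `σ(x) = (1/m) Σ_{a<m} (p(x⁽ᵃ⁾) − E p)`   on `Fin (m·N)` (block `a` = the variables `finProdFinEquiv (a, ·)`)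

has total degree `≤ d`, `|σ| ≤ 1`, `E σ = 0`, `E σ² = Var p/m`, `E σ⁴ ≤ Var p/m³ + 3 (Var p)²/m²` (fourth moment of
an i.i.d. sum: `E (Σ_a D_a)⁴ = m E D⁴ + 3m(m−1)(E D²)²`, `E D⁴ ≤ E D²` for `|D| ≤ 1`), and flipping the bit `(a,i)`
changes `σ` by `(p(x⁽ᵃ⁾) − p(x⁽ᵃ⁾ ⊕ e_i))/m`, so `Inf_{(a,i)} σ = Inf_i p/m²`.

THIS PART (1/2): the product cube `Fin (m·N) → Bool` as block families `Fin m → (Fin N → Bool)`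
(`sum_cube_blocks`, `block_glue`), independence of the blocks in the elementary form
`Σ_X h(X_a)·G(X) = (Σ_y h y)·(Σ_X G)/2^N` for `G` not depending on block `a` (`sum_mul_indep`, `sum_block`,
`sum_block_two`), and the MOMENTS OF AN INDEPENDENT SUM by induction on the number of blocks (`moments`:
`Σ W = 0`, `2^N Σ W² = m ΣD² (2^N)^m`, `4^N Σ W⁴ = m ΣD⁴ (2^N)^{m+1} + 3m(m−1)(ΣD²)²(2^N)^m`). Part 2/2
(`…StubAverage.lean`) builds `σ` and proves the registered stub `stub_average` BY NAME.
Elementary; no named facts, no new definitions.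
-/

-- D-0017: single-conjunct summit ⇒ the duplicate `QuantumAdvantage.QuantumAdvantage` is mandated.
set_option linter.dupNamespace false

noncomputable section

open Finset
open Literature.Computability.QuantumComplexity

namespace Summit.QuantumAdvantage.QuantumAdvantage.Cruxes.VarianceAmplification.AverageAndClip

namespace StubAverage

variable {N m : ℕ}

/-! ### The product cube `Fin (m·N) → Bool` as `m` blocks `Fin m → (Fin N → Bool)` -/

/-- Sum over the product cube = sum over block families (`x ↦ (a ↦ x|_block a)`). [folklore] -/
theorem sum_cube_blocks (F : (Fin (m * N) → Bool) → ℝ) :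
    ∑ x : Fin (m * N) → Bool, F x =
      ∑ X : Fin m → Fin N → Bool, F (fun k => X (finProdFinEquiv.symm k).1 (finProdFinEquiv.symm k).2) := by
  refine (Fintype.sum_equiv ((Equiv.curry (Fin m) (Fin N) Bool).symm.trans
    (finProdFinEquiv.arrowCongr (Equiv.refl Bool))) _ _ fun X => ?_).symm
  rfl

/-- Block `a` of the glued point is `X a`. [folklore] -/
theorem block_glue (X : Fin m → Fin N → Bool) (a : Fin m) :
    (fun i : Fin N => (fun k : Fin (m * N) => X (finProdFinEquiv.symm k).1 (finProdFinEquiv.symm k).2)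
      (finProdFinEquiv (a, i))) = X a := by
  funext i
  simp only [Equiv.symm_apply_apply]

/-- `2^(m·N) = (2^N)^m` as reals. [folklore] -/
theorem two_pow_mul : (2 : ℝ) ^ (m * N) = ((2 : ℝ) ^ N) ^ m := by
  rw [mul_comm, pow_mul]

/-! ### Independence of the blocks -/

/-- The fibre sums `Σ_{X : X a = y} G X` do not depend on `y` when `G` ignores block `a`. [folklore] -/
theorem sum_fibre_eq (a : Fin m) (G : (Fin m → Fin N → Bool) → ℝ)
    (hG : ∀ X y, G (Function.update X a y) = G X) (y y' : Fin N → Bool) :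
    ∑ X ∈ Finset.univ.filter (fun X : Fin m → Fin N → Bool => X a = y), G X =
      ∑ X ∈ Finset.univ.filter (fun X : Fin m → Fin N → Bool => X a = y'), G X := by
  refine Finset.sum_nbij' (fun X => Function.update X a y') (fun X => Function.update X a y) ?_ ?_ ?_ ?_ ?_
  · intro X _; simp
  · intro X _; simp
  · intro X hX
    rw [Finset.mem_filter] at hX
    rw [Function.update_idem, ← hX.2, Function.update_eq_self]
  · intro X hX
    rw [Finset.mem_filter] at hX
    rw [Function.update_idem, ← hX.2, Function.update_eq_self]
  · intro X _; rw [hG]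

/-- **Block independence**: `Σ_X h(X a)·G(X) = (Σ_y h y)·(Σ_X G X)/2^N` if `G` ignores block `a`. [folklore] -/
theorem sum_mul_indep (a : Fin m) (h : (Fin N → Bool) → ℝ) (G : (Fin m → Fin N → Bool) → ℝ)
    (hG : ∀ X y, G (Function.update X a y) = G X) :
    ∑ X : Fin m → Fin N → Bool, h (X a) * G X =
      (∑ y : Fin N → Bool, h y) * (∑ X : Fin m → Fin N → Bool, G X) / (2 : ℝ) ^ N := by
  classical
  -- a reference fibre
  obtain ⟨y₀⟩ : Nonempty (Fin N → Bool) := ⟨fun _ => false⟩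
  set S : ℝ := ∑ X ∈ Finset.univ.filter (fun X : Fin m → Fin N → Bool => X a = y₀), G X with hS
  have hfib : ∀ y, ∑ X ∈ Finset.univ.filter (fun X : Fin m → Fin N → Bool => X a = y), G X = S :=
    fun y => sum_fibre_eq a G hG y y₀
  -- decompose both sums along the fibres of `X ↦ X a`
  have hdec : ∀ F : (Fin m → Fin N → Bool) → ℝ, ∑ X, F X =
      ∑ y : Fin N → Bool, ∑ X ∈ Finset.univ.filter (fun X : Fin m → Fin N → Bool => X a = y), F X := by
    intro F
    rw [← Finset.sum_fiberwise_of_maps_to (s := Finset.univ) (t := Finset.univ) (g := fun X => X a)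
      (fun X _ => Finset.mem_univ _)]
  have h1 : ∑ X : Fin m → Fin N → Bool, h (X a) * G X = ∑ y : Fin N → Bool, h y * S := by
    rw [hdec]
    refine Finset.sum_congr rfl fun y _ => ?_
    rw [← hfib y, Finset.mul_sum]
    refine Finset.sum_congr rfl fun X hX => ?_
    rw [(Finset.mem_filter.mp hX).2]
  have h2 : ∑ X : Fin m → Fin N → Bool, G X = 2 ^ N * S := by
    rw [hdec]
    simp_rw [hfib]
    rw [Finset.sum_const, Finset.card_univ, Fintype.card_fun, Fintype.card_bool, Fintype.card_fin, nsmul_eq_mul]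
    push_cast; ring
  rw [h1, h2, ← Finset.sum_mul]
  field_simp

/-- Special case `G = 1`: `Σ_X h(X a) = (Σ_y h y)·(2^N)^m/2^N`. [folklore] -/
theorem sum_block (a : Fin m) (h : (Fin N → Bool) → ℝ) :
    ∑ X : Fin m → Fin N → Bool, h (X a) = (∑ y : Fin N → Bool, h y) * ((2 : ℝ) ^ N) ^ m / (2 : ℝ) ^ N := by
  have := sum_mul_indep a h (fun _ => (1 : ℝ)) (fun _ _ => rfl)
  simp only [mul_one, Finset.sum_const, Finset.card_univ, Fintype.card_fun, Fintype.card_bool, Fintype.card_fin,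
    nsmul_eq_mul, mul_one] at this
  rw [this]; push_cast; ring

/-- Two distinct blocks: `Σ_X h(X a)·g(X b) = (Σ h)(Σ g)(2^N)^m/4^N` for `a ≠ b`. [folklore] -/
theorem sum_block_two {a b : Fin m} (hab : a ≠ b) (h g : (Fin N → Bool) → ℝ) :
    ∑ X : Fin m → Fin N → Bool, h (X a) * g (X b) =
      (∑ y : Fin N → Bool, h y) * (∑ y : Fin N → Bool, g y) * ((2 : ℝ) ^ N) ^ m / ((2 : ℝ) ^ N) ^ 2 := by
  rw [sum_mul_indep a h (fun X => g (X b)) (fun X y => by rw [Function.update_of_ne hab.symm]), sum_block b g]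
  field_simp

/-! ### Moments of an independent sum, by induction on the number of blocks -/

/-- Sum over `Fin (m+1) → C` as a sum over the first block and the rest. [folklore] -/
theorem sum_succ_blocks (F : (Fin (m + 1) → Fin N → Bool) → ℝ) :
    ∑ X : Fin (m + 1) → Fin N → Bool, F X =
      ∑ y : Fin N → Bool, ∑ X' : Fin m → Fin N → Bool, F (Fin.cons y X') := by
  rw [← Fintype.sum_prod_type']
  exact (Fintype.sum_equiv (Fin.consEquiv fun _ => Fin N → Bool) (fun q => F (Fin.cons q.1 q.2)) F
    fun q => rfl).symm

/-- The block sum splits: `Σ_{a<m+1} D((cons y X') a) = D y + Σ_{a<m} D(X' a)`. [folklore] -/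
theorem blockSum_cons (D : (Fin N → Bool) → ℝ) (y : Fin N → Bool) (X' : Fin m → Fin N → Bool) :
    ∑ a : Fin (m + 1), D ((Fin.cons y X' : Fin (m + 1) → Fin N → Bool) a) = D y + ∑ a : Fin m, D (X' a) := by
  rw [Fin.sum_univ_succ]
  simp only [Fin.cons_zero, Fin.cons_succ]

/-- **Moments of an independent sum** (`Σ_y D y = 0`): writing `W(X) = Σ_a D(X a)` over `X : Fin m → C`,
`Σ_X W = 0`, `2^N Σ_X W² = m (Σ D²) (2^N)^m`, and
`4^N Σ_X W⁴ = m (Σ D⁴) (2^N)^{m+1} + 3 m (m−1) (Σ D²)² (2^N)^m`. [folklore: moments of i.i.d. sums] -/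
theorem moments (D : (Fin N → Bool) → ℝ) (hD0 : ∑ y, D y = 0) : ∀ m : ℕ,
    (∑ X : Fin m → Fin N → Bool, ∑ a, D (X a) = 0) ∧
    ((2 : ℝ) ^ N * ∑ X : Fin m → Fin N → Bool, (∑ a, D (X a)) ^ 2 =
        m * (∑ y, D y ^ 2) * ((2 : ℝ) ^ N) ^ m) ∧
    (((2 : ℝ) ^ N) ^ 2 * ∑ X : Fin m → Fin N → Bool, (∑ a, D (X a)) ^ 4 =
        m * (∑ y, D y ^ 4) * ((2 : ℝ) ^ N) ^ (m + 1) +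
          3 * m * ((m : ℝ) - 1) * (∑ y, D y ^ 2) ^ 2 * ((2 : ℝ) ^ N) ^ m) := by
  intro m
  induction m with
  | zero => simp
  | succ m ih =>
    obtain ⟨ih1, ih2, ih4⟩ := ih
    have hcardC : (Fintype.card (Fin N → Bool) : ℝ) = (2 : ℝ) ^ N := by
      rw [Fintype.card_fun, Fintype.card_bool, Fintype.card_fin]; push_cast; ring
    have hcardX : (Fintype.card (Fin m → Fin N → Bool) : ℝ) = ((2 : ℝ) ^ N) ^ m := by
      rw [Fintype.card_fun, Fintype.card_fun, Fintype.card_bool, Fintype.card_fin, Fintype.card_fin]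
      push_cast; ring
    -- generic double-sum evaluations
    have hconstY : ∀ g : (Fin m → Fin N → Bool) → ℝ,
        ∑ _y : Fin N → Bool, ∑ X' : Fin m → Fin N → Bool, g X' = (2 : ℝ) ^ N * ∑ X' : Fin m → Fin N → Bool, g X' := by
      intro g; rw [Finset.sum_const, Finset.card_univ, nsmul_eq_mul, hcardC]
    have hconstX : ∀ f : (Fin N → Bool) → ℝ,
        ∑ y : Fin N → Bool, ∑ _X' : Fin m → Fin N → Bool, f y = ((2 : ℝ) ^ N) ^ m * ∑ y : Fin N → Bool, f y := by
      intro f; rw [Finset.mul_sum]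
      refine Finset.sum_congr rfl fun y _ => ?_
      rw [Finset.sum_const, Finset.card_univ, nsmul_eq_mul, hcardX]
    have hprod : ∀ (f : (Fin N → Bool) → ℝ) (g : (Fin m → Fin N → Bool) → ℝ),
        ∑ y : Fin N → Bool, ∑ X' : Fin m → Fin N → Bool, f y * g X' =
          (∑ y : Fin N → Bool, f y) * ∑ X' : Fin m → Fin N → Bool, g X' := by
      intro f g; rw [Finset.sum_mul_sum]
    refine ⟨?_, ?_, ?_⟩
    · rw [sum_succ_blocks]
      simp_rw [blockSum_cons, Finset.sum_add_distrib]
      rw [hconstX, hconstY, hD0, ih1]; ring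
    · rw [sum_succ_blocks]
      simp_rw [blockSum_cons]
      have e : ∀ (y : Fin N → Bool) (X' : Fin m → Fin N → Bool),
          (D y + ∑ a, D (X' a)) ^ 2 = D y ^ 2 + (2 * D y) * (∑ a, D (X' a)) + (∑ a, D (X' a)) ^ 2 := by
        intro y X'; ring
      simp_rw [e, Finset.sum_add_distrib]
      rw [hconstX, hprod, hconstY, ih1]
      push_cast
      linear_combination (2 : ℝ) ^ N * ih2
    · rw [sum_succ_blocks]
      simp_rw [blockSum_cons]
      have e : ∀ (y : Fin N → Bool) (X' : Fin m → Fin N → Bool),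
          (D y + ∑ a, D (X' a)) ^ 4 = D y ^ 4 + (4 * D y ^ 3) * (∑ a, D (X' a)) +
            (6 * D y ^ 2) * (∑ a, D (X' a)) ^ 2 + (4 * D y) * (∑ a, D (X' a)) ^ 3 + (∑ a, D (X' a)) ^ 4 := by
        intro y X'; ring
      simp_rw [e, Finset.sum_add_distrib]
      rw [hconstX, hprod, hprod, hprod, hconstY, ih1]
      have h4D : ∑ y : Fin N → Bool, 4 * D y = 0 := by rw [← Finset.mul_sum, hD0, mul_zero]
      rw [h4D]
      have h6 : ∑ y : Fin N → Bool, 6 * D y ^ 2 = 6 * ∑ y : Fin N → Bool, D y ^ 2 := by rw [Finset.mul_sum]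
      rw [h6]
      push_cast
      linear_combination (6 * (∑ y : Fin N → Bool, D y ^ 2) * (2 : ℝ) ^ N) * ih2 + (2 : ℝ) ^ N * ih4

end StubAverage

end Summit.QuantumAdvantage.QuantumAdvantage.Cruxes.VarianceAmplification.AverageAndClip

end
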